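import Summits.KontsevichZagierPeriods.Zeta5Search.LaiSweepShard

/-!
# `κ₃` sweep certificate — shard file 049 of 127 (shards 343–349 of 889)

HONEST FRAMING. Systematic search; no irrationality claim unless certified. This file only checks,
by `decide +kernel`, shards 343–349 of the order-cell sweep of the `κ₃` point `(74, 2180, 444; δ74)`
(engine `LaiSweepEngine`, soundness `LaiSweepJump/Free/Eval/Shard/Kappa3`; a shard is `⟨regime, n,
p, q, p', q', Lo, Up⟩`: `n` cells from `p/q` to `p'/q'` with integer rate sums in `[Lo, Up]`, `K =
128`, `D = 2^40`). It draws NO conclusion: only the capstone `LaiKappa3SweepCert`, which needs all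
127 shard files, does. Kernel cost of this file ≈ 560 cells × 0.3 s.
-/

namespace Summit.KontsevichZagierPeriods.Zeta5Search.Sweep

set_option maxHeartbeats 100000000 in
/-- Shard 343: 80 cells of regime B from `121/386` to `62/197`.
[cite: Lai2024BallRivoal, §4 Lemma 4.3] -/
theorem shard343 :
    Shard.check 128 (2^40)
      ⟨true, 80, 121, 386, 62, 197, 21633490595963, 23347359670940⟩ = true := by
  decide +kernel

set_option maxHeartbeats 100000000 in
/-- Shard 344: 80 cells of regime B from `62/197` to `79/250`.
[cite: Lai2024BallRivoal, §4 Lemma 4.3] -/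
theorem shard344 :
    Shard.check 128 (2^40)
      ⟨true, 80, 62, 197, 79, 250, 22062142273978, 23826744189338⟩ = true := by
  decide +kernel

set_option maxHeartbeats 100000000 in
/-- Shard 345: 80 cells of regime B from `79/250` to `46/145`.
[cite: Lai2024BallRivoal, §4 Lemma 4.3] -/
theorem shard345 :
    Shard.check 128 (2^40)
      ⟨true, 80, 79, 250, 46, 145, 21342423841548, 23063824991964⟩ = true := by
  decide +kernel

set_option maxHeartbeats 100000000 in
/-- Shard 346: 80 cells of regime B from `46/145` to `136/427`.
[cite: Lai2024BallRivoal, §4 Lemma 4.3] -/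
theorem shard346 :
    Shard.check 128 (2^40)
      ⟨true, 80, 46, 145, 136, 427, 21590270168738, 23347642668468⟩ = true := by
  decide +kernel

set_option maxHeartbeats 100000000 in
/-- Shard 347: 80 cells of regime B from `136/427` to `47/147`.
[cite: Lai2024BallRivoal, §4 Lemma 4.3] -/
theorem shard347 :
    Shard.check 128 (2^40)
      ⟨true, 80, 136, 427, 47, 147, 20962990342680, 22683729224904⟩ = true := by
  decide +kernel

set_option maxHeartbeats 100000000 in
/-- Shard 348: 80 cells of regime B from `47/147` to `139/433`.
[cite: Lai2024BallRivoal, §4 Lemma 4.3] -/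
theorem shard348 :
    Shard.check 128 (2^40)
      ⟨true, 80, 47, 147, 139, 433, 21932051572086, 23748619936943⟩ = true := by
  decide +kernel

set_option maxHeartbeats 100000000 in
/-- Shard 349: 80 cells of regime B from `139/433` to `97/301`.
[cite: Lai2024BallRivoal, §4 Lemma 4.3] -/
theorem shard349 :
    Shard.check 128 (2^40)
      ⟨true, 80, 139, 433, 97, 301, 21077520035209, 22838641149057⟩ = true := by
  decide +kernel

/-- The checked shards of this file, in order. [folklore] -/
def shards049 : List (CheckedShard 128 (2^40)) :=
  [⟨_, shard343⟩, ⟨_, shard344⟩, ⟨_, shard345⟩, ⟨_, shard346⟩, ⟨_, shard347⟩,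
    ⟨_, shard348⟩, ⟨_, shard349⟩]

end Summit.KontsevichZagierPeriods.Zeta5Search.Sweep
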